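import Mathlib.Analysis.InnerProductSpace.Adjoint
import HarnessLib

/-!
# Hellmann–Feynman values from a certified APPROXIMATE top eigenvector (Kato–Temple / Davis–Kahan,
# single-vector form) — PROVED

Topic `Literature/Analysis/OperatorTheory`; companion of `KatoTempleInequality.lean`,
`RitzSubspaceProximity.lean` (single-vector exclusion `norm_proj_le_residual_div_gap`) and of
`DiagonalCongruenceNormConvex.lean` / `GramLaplaceNormLogConvex.lean` (secant brackets for the
Hellmann–Feynman value `⟪ψ, A ψ⟫` of an EXACT normalised top eigenvector `ψ`). Theorems only.

Certified numerics never hold `ψ` exactly: they hold a unit vector `v` with a small RESIDUAL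
`‖T v - m v‖ ≤ ρ` and a certified GAP below `m` (`⟪w, T w⟫ ≤ b ‖w‖²` on `ψ^⊥`, `b < m`). This file
proves, on any real inner product space and for any symmetric bounded `T` with `T ψ = Λ ψ`, `‖ψ‖ = 1`:

* `norm_sub_inner_smul_le_residual_div_gap` — **`sin θ ≤ ρ/(m-b)`**: the component of `v` orthogonal
  to `ψ` has norm `‖v - ⟪ψ,v⟫ ψ‖ ≤ ρ/(m - b)` (decompose `v = cψ + w`; `T v - m v = c(Λ-m)ψ + (T w - m w)`
  with the two pieces orthogonal, so `‖T w - m w‖ ≤ ρ`; and `(m-b)‖w‖² ≤ ⟪w, (m-T) w⟫ ≤ ‖w‖ ρ`) — the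
  one-vector case of the Davis–Kahan `sin Θ` theorem [cite: DavisKahan1970, §2 (sin Θ theorem)] in
  the form printed as Saad's Thm. 3.9, (3.24) `sin θ(ũ, u) ≤ ‖r‖₂/δ` (here one-sided: `u` the TOP
  eigenvector, `δ` replaced by the certified gap `m - b` below the shift) [cite: Saad1992, Ch. III
  Thm. 3.9 (3.24), with Lemma 3.2 / Thm. 3.8 (Kato–Temple) (PDF pp. 139–140)] [cite: Kato1949, Lemma 2];
* `abs_inner_sub_inner_le_of_orth_component` — for ANY bounded `A` and unit `v`, `ψ` with
  `‖v - ⟪ψ,v⟫ ψ‖ ≤ δ`: `|⟪v, A v⟫ - ⟪ψ, A ψ⟫| ≤ 2‖A‖(δ + δ²)` (expand `v = cψ + w`, `c² = 1 - ‖w‖²`);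
* `abs_inner_sub_hellmannFeynman_le` — the two combined: the computable `⟪v, A v⟫` encloses the
  Hellmann–Feynman value `⟪ψ, A ψ⟫` of the exact top eigenvector within `2‖A‖(δ + δ²)`, `δ = ρ/(m-b)`.

The sign ambiguity `ψ ↦ -ψ` is immaterial (`⟪ψ, A ψ⟫` is even in `ψ`), so no orientation hypothesis
`⟪ψ, v⟫ ≥ 0` is needed. Nothing here is specific to matrices; for a real symmetric matrix `W` take
`T = Matrix.toEuclideanCLM W` on `EuclideanSpace ℝ S`.

## References
* Y. Saad, *Numerical Methods for Large Eigenvalue Problems*, Manchester UP 1992, Ch. III §1.1,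
  §3.2: Lemma 3.2, Thm. 3.8 (Kato–Temple), Thm. 3.9 (3.24) (angle bound); held copy
  `paper:galaxy-pdf-7957869842747599420` PDF pp. 124, 139–140. [Saad1992]
* C. Davis, W. M. Kahan, *The rotation of eigenvectors by a perturbation. III*, SIAM J. Numer. Anal. 7
  (1970) 1–46, §2. [DavisKahan1970]
* T. Kato, *On the upper and lower bounds of eigenvalues*, J. Phys. Soc. Japan 4 (1949) 334–339.
  [Kato1949]
-/

noncomputable section

open scoped RealInnerProductSpace

namespace Literature.Analysis.OperatorTheory

section ApproxTopVector

variable {E : Type*} [NormedAddCommGroup E] [InnerProductSpace ℝ E]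

/-- The component `v - ⟪ψ,v⟫ ψ` is orthogonal to the unit vector `ψ`. [cite: Saad1992, Ch. III §1.1
(orthogonal projectors, PDF p. 124)] -/
theorem inner_self_sub_inner_smul_eq_zero {ψ : E} (hψ : ‖ψ‖ = 1) (v : E) :
    ⟪ψ, v - ⟪ψ, v⟫ • ψ⟫ = 0 := by
  rw [inner_sub_right, real_inner_smul_right, real_inner_self_eq_norm_sq, hψ, one_pow, mul_one,
    sub_self]

/-- The same orthogonality with `ψ` on the right. [cite: Saad1992, Ch. III §1.1 (PDF p. 124)] -/
theorem inner_sub_inner_smul_eq_zero {ψ : E} (hψ : ‖ψ‖ = 1) (v : E) :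
    ⟪v - ⟪ψ, v⟫ • ψ, ψ⟫ = 0 := by
  rw [real_inner_comm]
  exact inner_self_sub_inner_smul_eq_zero hψ v

/-- Pythagoras for the decomposition `v = ⟪ψ,v⟫ ψ + w`: `‖v‖² = ⟪ψ,v⟫² + ‖v - ⟪ψ,v⟫ ψ‖²` for a unit
vector `ψ`. [cite: Saad1992, Ch. III §1.1 (PDF p. 124)] -/
theorem norm_sq_eq_inner_sq_add_norm_orth_sq {ψ : E} (hψ : ‖ψ‖ = 1) (v : E) :
    ‖v‖ ^ 2 = ⟪ψ, v⟫ ^ 2 + ‖v - ⟪ψ, v⟫ • ψ‖ ^ 2 := by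
  have horth : ⟪⟪ψ, v⟫ • ψ, v - ⟪ψ, v⟫ • ψ⟫ = 0 := by
    rw [real_inner_smul_left, inner_self_sub_inner_smul_eq_zero hψ, mul_zero]
  have h := norm_add_sq_eq_norm_sq_add_norm_sq_of_inner_eq_zero _ _ horth
  rw [add_sub_cancel, norm_smul, Real.norm_eq_abs, hψ, mul_one, abs_mul_abs_self] at h
  simpa [sq] using h

/-- **`sin θ ≤ residual/gap` for the top eigenvector** (Kato–Temple / Davis–Kahan, one-vector form).
Let `T` be a symmetric bounded operator on a real inner product space, `ψ` a unit eigenvector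
(`T ψ = Λ ψ`), and suppose the Rayleigh quotient on `ψ^⊥` is at most `b` (`⟪w, T w⟫ ≤ b ‖w‖²` whenever
`⟪w, ψ⟫ = 0`; e.g. `b = λ₂`). If a vector `v` has residual `‖T v - m v‖ ≤ ρ` for some shift `m > b`,
then its component orthogonal to `ψ` satisfies `‖v - ⟪ψ,v⟫ ψ‖ ≤ ρ/(m - b)` (Saad's proof of (3.24)
verbatim: `T v - m v = c(Λ - m)ψ + (T w - m w)` with the two summands orthogonal).
[cite: Saad1992, Ch. III Thm. 3.9 (3.24) (PDF p. 140)] [cite: DavisKahan1970, §2] [cite: Kato1949, Lemma 2] -/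
theorem norm_sub_inner_smul_le_residual_div_gap (T : E →L[ℝ] E)
    (hT : ∀ x y : E, ⟪T x, y⟫ = ⟪x, T y⟫) {ψ : E} (hψ : ‖ψ‖ = 1) {Λ : ℝ} (heig : T ψ = Λ • ψ)
    {b m ρ : ℝ} (hbm : b < m) (hgap : ∀ w : E, ⟪w, ψ⟫ = 0 → ⟪w, T w⟫ ≤ b * ‖w‖ ^ 2)
    {v : E} (hres : ‖T v - m • v‖ ≤ ρ) :
    ‖v - ⟪ψ, v⟫ • ψ‖ ≤ ρ / (m - b) := by
  set c : ℝ := ⟪ψ, v⟫ with hc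
  set w : E := v - c • ψ with hw
  have hwψ : ⟪w, ψ⟫ = 0 := inner_sub_inner_smul_eq_zero hψ v
  -- `T v - m v = (T w - m w) + c (Λ - m) ψ`, the two summands orthogonal
  have hdec : T v - m • v = (T w - m • w) + (c * (Λ - m)) • ψ := by
    have hv : v = w + c • ψ := by rw [hw, sub_add_cancel]
    rw [hv, map_add, map_smul, heig, smul_smul, smul_add]
    module
  have horth : ⟪T w - m • w, (c * (Λ - m)) • ψ⟫ = 0 := by
    rw [real_inner_smul_right, inner_sub_left, real_inner_smul_left, hT, heig, real_inner_smul_right,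
      hwψ, mul_zero, mul_zero, sub_self, mul_zero]
  have hres_w : ‖T w - m • w‖ ≤ ρ := by
    have hpy := norm_add_sq_eq_norm_sq_add_norm_sq_of_inner_eq_zero _ _ horth
    rw [← hdec] at hpy
    have h1 : ‖T w - m • w‖ ^ 2 ≤ ‖T v - m • v‖ ^ 2 := by
      rw [sq, sq, hpy]; nlinarith [sq_nonneg ‖(c * (Λ - m)) • ψ‖]
    have h2 : ‖T w - m • w‖ ≤ ‖T v - m • v‖ := by
      nlinarith [norm_nonneg (T w - m • w), norm_nonneg (T v - m • v)]
    exact h2.trans hres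
  -- `(m - b) ‖w‖² ≤ ⟪w, m w - T w⟫ ≤ ‖w‖ ρ`
  have hkey : (m - b) * ‖w‖ ^ 2 ≤ ‖w‖ * ρ := by
    have h1 : (m - b) * ‖w‖ ^ 2 ≤ ⟪w, m • w - T w⟫ := by
      rw [inner_sub_right, real_inner_smul_right, real_inner_self_eq_norm_sq]
      have := hgap w hwψ
      linarith
    have h2 : ⟪w, m • w - T w⟫ ≤ ‖w‖ * ‖m • w - T w‖ := real_inner_le_norm _ _
    have h3 : ‖m • w - T w‖ = ‖T w - m • w‖ := norm_sub_rev _ _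
    calc (m - b) * ‖w‖ ^ 2 ≤ ‖w‖ * ‖m • w - T w‖ := h1.trans h2
      _ ≤ ‖w‖ * ρ := by rw [h3]; exact mul_le_mul_of_nonneg_left hres_w (norm_nonneg _)
  have hmb : 0 < m - b := sub_pos.mpr hbm
  have hρ : 0 ≤ ρ := (norm_nonneg _).trans hres
  rw [le_div_iff₀ hmb]
  by_cases hw0 : ‖w‖ = 0
  · rw [hw0, zero_mul]; exact hρ
  · have hwpos : 0 < ‖w‖ := lt_of_le_of_ne (norm_nonneg _) (Ne.symm hw0)
    have : (m - b) * ‖w‖ * ‖w‖ ≤ ρ * ‖w‖ := by nlinarith [hkey]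
    rw [mul_comm (m - b)] at this
    exact le_of_mul_le_mul_right (by nlinarith [this]) hwpos

/-- **A quadratic form at a nearby unit vector.** For any bounded `A`, unit vectors `ψ`, `v` with
`‖v - ⟪ψ,v⟫ ψ‖ ≤ δ`: `|⟪v, A v⟫ - ⟪ψ, A ψ⟫| ≤ 2 ‖A‖ (δ + δ²)` (write `v = cψ + w`, `c² = 1 - ‖w‖²`:
the difference is `-‖w‖² ⟪ψ,Aψ⟫ + c ⟪ψ, A w⟫ + c ⟪w, A ψ⟫ + ⟪w, A w⟫`). The value `⟪ψ, A ψ⟫` is even in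
`ψ`, so no orientation of `ψ` relative to `v` is needed. [cite: Saad1992, Ch. III §3.2 (a posteriori
bounds from an approximate eigenvector, PDF pp. 139–140)] -/
theorem abs_inner_sub_inner_le_of_orth_component (A : E →L[ℝ] E) {ψ v : E} (hψ : ‖ψ‖ = 1)
    (hv : ‖v‖ = 1) {δ : ℝ} (hδ : ‖v - ⟪ψ, v⟫ • ψ‖ ≤ δ) :
    |⟪v, A v⟫ - ⟪ψ, A ψ⟫| ≤ 2 * ‖A‖ * (δ + δ ^ 2) := by
  set c : ℝ := ⟪ψ, v⟫ with hc
  set w : E := v - c • ψ with hw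
  have hw0 : 0 ≤ ‖w‖ := norm_nonneg _
  have hδ0 : 0 ≤ δ := hw0.trans hδ
  have hc2 : c ^ 2 = 1 - ‖w‖ ^ 2 := by
    have h := norm_sq_eq_inner_sq_add_norm_orth_sq hψ v
    rw [hv, one_pow] at h
    linarith
  have hcabs : |c| ≤ 1 := by
    have : c ^ 2 ≤ 1 := by nlinarith [sq_nonneg ‖w‖]
    exact abs_le_one_iff_mul_self_le_one.mpr (by nlinarith [this])
  have hv' : v = c • ψ + w := by rw [hw, add_sub_cancel]
  -- expand the quadratic form
  have hexp : ⟪v, A v⟫ - ⟪ψ, A ψ⟫ =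
      -(‖w‖ ^ 2) * ⟪ψ, A ψ⟫ + c * ⟪ψ, A w⟫ + c * ⟪w, A ψ⟫ + ⟪w, A w⟫ := by
    rw [hv', map_add, map_smul, inner_add_left, inner_add_right, inner_add_right,
      real_inner_smul_left, real_inner_smul_left, real_inner_smul_right, real_inner_smul_right]
    have : c * (c * ⟪ψ, A ψ⟫) = (1 - ‖w‖ ^ 2) * ⟪ψ, A ψ⟫ := by rw [← hc2]; ring
    rw [this]; ring
  -- bound each term
  have b1 : |⟪ψ, A ψ⟫| ≤ ‖A‖ := by
    calc |⟪ψ, A ψ⟫| ≤ ‖ψ‖ * ‖A ψ‖ := abs_real_inner_le_norm _ _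
      _ ≤ ‖ψ‖ * (‖A‖ * ‖ψ‖) := by gcongr; exact A.le_opNorm ψ
      _ = ‖A‖ := by rw [hψ, one_mul, mul_one]
  have b2 : |⟪ψ, A w⟫| ≤ ‖A‖ * ‖w‖ := by
    calc |⟪ψ, A w⟫| ≤ ‖ψ‖ * ‖A w‖ := abs_real_inner_le_norm _ _
      _ ≤ ‖ψ‖ * (‖A‖ * ‖w‖) := by gcongr; exact A.le_opNorm w
      _ = ‖A‖ * ‖w‖ := by rw [hψ, one_mul]
  have b3 : |⟪w, A ψ⟫| ≤ ‖A‖ * ‖w‖ := by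
    calc |⟪w, A ψ⟫| ≤ ‖w‖ * ‖A ψ‖ := abs_real_inner_le_norm _ _
      _ ≤ ‖w‖ * (‖A‖ * ‖ψ‖) := by gcongr; exact A.le_opNorm ψ
      _ = ‖A‖ * ‖w‖ := by rw [hψ, mul_one, mul_comm]
  have b4 : |⟪w, A w⟫| ≤ ‖A‖ * ‖w‖ ^ 2 := by
    calc |⟪w, A w⟫| ≤ ‖w‖ * ‖A w‖ := abs_real_inner_le_norm _ _
      _ ≤ ‖w‖ * (‖A‖ * ‖w‖) := by gcongr; exact A.le_opNorm w
      _ = ‖A‖ * ‖w‖ ^ 2 := by ring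
  have hA0 : 0 ≤ ‖A‖ := norm_nonneg _
  rw [hexp]
  calc |-(‖w‖ ^ 2) * ⟪ψ, A ψ⟫ + c * ⟪ψ, A w⟫ + c * ⟪w, A ψ⟫ + ⟪w, A w⟫|
      ≤ |-(‖w‖ ^ 2) * ⟪ψ, A ψ⟫| + |c * ⟪ψ, A w⟫| + |c * ⟪w, A ψ⟫| + |⟪w, A w⟫| := by
        refine (abs_add_le _ _).trans ?_
        gcongr
        refine (abs_add_le _ _).trans ?_
        gcongr
        exact abs_add_le _ _
    _ ≤ ‖w‖ ^ 2 * ‖A‖ + ‖A‖ * ‖w‖ + ‖A‖ * ‖w‖ + ‖A‖ * ‖w‖ ^ 2 := by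
        gcongr
        · rw [abs_mul, abs_neg, abs_of_nonneg (sq_nonneg _)]
          exact mul_le_mul_of_nonneg_left b1 (sq_nonneg _)
        · rw [abs_mul]
          calc |c| * |⟪ψ, A w⟫| ≤ 1 * (‖A‖ * ‖w‖) :=
                mul_le_mul hcabs b2 (abs_nonneg _) zero_le_one
            _ = ‖A‖ * ‖w‖ := one_mul _
        · rw [abs_mul]
          calc |c| * |⟪w, A ψ⟫| ≤ 1 * (‖A‖ * ‖w‖) :=
                mul_le_mul hcabs b3 (abs_nonneg _) zero_le_one
            _ = ‖A‖ * ‖w‖ := one_mul _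
    _ = 2 * ‖A‖ * (‖w‖ + ‖w‖ ^ 2) := by ring
    _ ≤ 2 * ‖A‖ * (δ + δ ^ 2) := by
        refine mul_le_mul_of_nonneg_left ?_ (by positivity)
        nlinarith [hδ, hw0, hδ0]

/-- **The Hellmann–Feynman value from a certified approximate top vector.** Let `T` be symmetric and
bounded with unit eigenvector `ψ` (`T ψ = Λ ψ`), Rayleigh quotient `≤ b` on `ψ^⊥`, and let `v` be a unit
vector with residual `‖T v - m v‖ ≤ ρ` for a shift `m > b`. Then for every bounded `A` (e.g. the
coupling derivative `∂T/∂β`), the computable number `⟪v, A v⟫` encloses the exact Hellmann–Feynman value: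
`|⟪v, A v⟫ - ⟪ψ, A ψ⟫| ≤ 2 ‖A‖ (δ + δ²)` with `δ = ρ/(m - b)`.
[cite: Saad1992, Ch. III Thm. 3.9 (3.24) (PDF p. 140)] [cite: DavisKahan1970, §2] -/
theorem abs_inner_sub_hellmannFeynman_le (T A : E →L[ℝ] E)
    (hT : ∀ x y : E, ⟪T x, y⟫ = ⟪x, T y⟫) {ψ : E} (hψ : ‖ψ‖ = 1) {Λ : ℝ} (heig : T ψ = Λ • ψ)
    {b m ρ : ℝ} (hbm : b < m) (hgap : ∀ w : E, ⟪w, ψ⟫ = 0 → ⟪w, T w⟫ ≤ b * ‖w‖ ^ 2)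
    {v : E} (hv : ‖v‖ = 1) (hres : ‖T v - m • v‖ ≤ ρ) :
    |⟪v, A v⟫ - ⟪ψ, A ψ⟫| ≤ 2 * ‖A‖ * (ρ / (m - b) + (ρ / (m - b)) ^ 2) :=
  abs_inner_sub_inner_le_of_orth_component A hψ hv
    (norm_sub_inner_smul_le_residual_div_gap T hT hψ heig hbm hgap hres)

end ApproxTopVector

end Literature.Analysis.OperatorTheory

end
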